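import Summits.QuantumFields.YangMills.Theorems.BalabanUVNodesN12FlatChartHnd
import HarnessLib

/-!
# BalabanUVNodes ∕ N12 — (β)♭ FOR A GENERAL DETERMINING SET `𝐁 = {Γ_j}_{j ≤ k}` ([Balaban1988Convergent] (2.2)): THE NULL SPACE OF THE FLAT SECOND VARIATION ON THE JOINT LINEARISED FIBRE
# `Q^{(j)}X = 0 on the bonds meeting Γ_j, j ≤ k` IS `{dφ : φ constant along every constrained bond at the j-fold centres}` — MODULO ONE DISPLAYED GEOMETRIC LETTER (L) ON `𝐁` (an essential
# loop of constrained bonds in every direction); it SHRINKS to `Lie (4) = {dφ : φ = 0 at the constrained centres}` exactly when the constrained-centre graph is connected (letter (C)) —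
# and the nondegeneracy ∕ positivity letter at NODE 00's flat multi-scale chart for such `𝐁`, modulo (L) and a slice letter in the locally-constant form

Cell `pub-ymgap` (HUMAN RULINGS D-0062 ∕ D-0149), WIDTH SEAT `pub-ymgap-dag-n12-w3` g2 (node N12 = [B15]; key K1⁷ `stmt-QuantumFields-20542`, `--kind proof --supports … --as helper`;
count-neutral).  THEOREMS ONLY (0 `def`, 0 `instance`, 0 `sorry`); every input CONSUMED BY NAME: this seat's `N12FlatFibreNullSpace` (matrix Poincaré lemma, `iterLin_dirConst`,
`mem_of_sub_mem`) and `N12FlatChartHnd` (`coe_plaq_eq_zero_of_deriv_deriv_eq_zero`, `deriv_deriv_wilsonAction4_expChart_one_nonneg`); the route UnitScaleTilt's `Prop7CombGauge.iterLin_add`,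
`Prop7AvgLinearisation.iterLin_grad`; dag-n10-w1's `N12FlatChartDerivIterLin.fderiv_msChart_one_apply_eq_iterLin` ∕ `iterLin_mem_lieSU`; n07-w2's `Node00.msChart` ∕ `coe_suProj_of_mem`.

WHY.  The files `N12FlatFibreNullSpace` ∕ `N12FlatChartHnd` treat the whole-lattice `k`-fold constraint (`𝐁 ⊇ atScale k`, [Balaban1985Variational] (5)); the (1.74) object of
[Balaban1989LargeFieldI] Prop. 1 carries the MULTI-LEVEL determining sets `𝔹_k^{(n)}` of (1.14)–(1.16) (`B15DeterminingSets.detSetN ∕ detSetTop`), whose members `Γ_j` sit at different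
scales in different regions.  For such `𝐁` two geometric facts enter, DISPLAYED here as letters: (L) for every direction `μ` some level `j ≤ k` carries a nonempty `e_μ`-invariant set of
sites all of whose `μ`-bonds are constrained (an essential loop — kills the constant vector function of the torus Poincaré lemma; at the record: the finest member `Γ₀ = Ω₁ᶜ` contains whole
lattice lines), and (C) the graph of constrained centres (edges = constrained bonds of all levels, read on the finest lattice) is connected.  LOCATED: the flat null space on the joint
kernel is `{dφ : φ LOCALLY constant on that graph}` (modulo (L) only, §1) — for a DISCONNECTED graph this is strictly larger than `Lie (4)` (at the exactly flat datum the symmetry group of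
the joint fibre exceeds the group (4) of transformations trivial at the constrained centres), so the slice letter for `hnd` is stated against the locally-constant pure gauges; (C) is
needed only to identify the null space with `Lie (4)`.  Neither (L) nor (C) is proved here for NODE 00's `Bj`∕`detSetTop`.

CONTENTS.
§1 `sum_shift_finset_eq` (re-indexing a sum over an `e_μ`-invariant finite set of sites), ★★★ `exists_locConstGauge_of_plaq_eq_zero_of_iterLin_eq_zero_detSet` (the null-space theorem for
   general `𝐁` modulo (L): `X = dφ`, `φ` constant along every constrained bond at the centres), ★★ `plaq_eq_zero_and_iterLin_eq_zero_iff_detSet` (the characterisation), ★★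
   `exists_constrGauge_of_plaq_eq_zero_of_iterLin_eq_zero_detSet` (under (C): `φ = 0` at every constrained centre — the `Lie (4)` form), ★★ `eq_zero_of_transversal_of_iterLin_eq_zero_detSet`
   (the `hnd` shape on a slice transversal to the locally-constant pure gauges, modulo (L)).
§2 at NODE 00's objects (the chart `msChart … k 𝐁` reads the members of `𝐁` up to level `k`; members above `k`, if any, are not constraints of the chart and are not used): `iterLin_eq_zero_of_fderiv_msChart_one_eq_zero_detSet`,
   ★★★ `eq_zero_of_fderiv_msChart_one_eq_zero_of_transversal_detSet`, ★★ `deriv_deriv_pos_of_fderiv_msChart_one_eq_zero_of_transversal_detSet`.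
§3 sanity instance: `hloop_atScale`, `hconn_atScale` — the whole-lattice `k`-fold constraint `atScale k` satisfies (L) and (C) (recovering the hypotheses-free `N12FlatFibreNullSpace`).

HONEST FRAMING.  Flat configuration only; letters (L) (everywhere), (C) (in the `Lie (4)` form only) and the slice letter DISPLAYED; no constants; nothing of Bałaban's estimates asserted; N12 NOT discharged; K1⁷ NOT closed; counts
unmoved (typed 28∕28 · discharged 5∕27); one finite 𝕋⁴ programme at fixed ε — R4 closes the conditional rung `BalabanLadder.UV` only; the Yang–Mills mass gap (Clay) is NOT proved by any
of this; nothing continuum ∕ ℝ⁴ ∕ OS.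
-/

noncomputable section

open scoped BigOperators Matrix.Norms.L2Operator Topology

namespace Summit.QuantumFields.YangMills.BalabanUVNodes.N12FlatFibreNullSpaceDetSet

open Literature.MathematicalPhysics.QuantumFieldTheory.Balaban1983to89
open T4Continuum (T4Family)
open BlockAveragingEMLLinearised (linAvg)
open T4AdjointCovarianceUnitary (lieSU)
open B15DeterminingSets
open LatticeFieldCalculus (shiftEquiv)
open Node00
open Summit.QuantumFields.YangMills.Theorems.Prop7CombGauge (iterLin_add)
open Summit.QuantumFields.YangMills.Theorems.Prop7AvgLinearisation (iterLin_grad)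
open Summit.QuantumFields.YangMills.BalabanUVNodes.N12FlatFibreNullSpace
  (exists_grad_add_dirConst_of_plaq_eq_zero_matrix iterLin_dirConst mem_of_sub_mem)
open Summit.QuantumFields.YangMills.BalabanUVNodes.N12FlatChartDerivIterLin (fderiv_msChart_one_apply_eq_iterLin iterLin_mem_lieSU)
open Summit.QuantumFields.YangMills.BalabanUVNodes.N12FlatChartHnd (coe_plaq_eq_zero_of_deriv_deriv_eq_zero deriv_deriv_wilsonAction4_expChart_one_nonneg)

/-! ## §1 On the torus: general determining sets -/

section Torus

variable {P : Params} {n : Type*} [Fintype n] [DecidableEq n]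

/-- Re-indexing a sum over a finite `e_μ`-INVARIANT set of sites by the unit translation (injective, hence a permutation of the set). [folklore] -/
theorem sum_shift_finset_eq {j : ℕ} {V : Type*} [AddCommMonoid V] (μ : Fin P.d) (R : Finset (Site P j)) (hR : ∀ y ∈ R, y.shift μ ∈ R)
    (F : Site P j → V) : ∑ y ∈ R, F (y.shift μ) = ∑ y ∈ R, F y := by
  classical
  have hinj : Function.Injective (fun y : Site P j => y.shift μ) := (shiftEquiv μ).injective
  have himg : R.image (fun y : Site P j => y.shift μ) = R := by
    refine Finset.eq_of_subset_of_card_le (fun z hz => ?_) ?_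
    · obtain ⟨y, hy, rfl⟩ := Finset.mem_image.1 hz
      exact hR y hy
    · rw [Finset.card_image_of_injective R hinj]
  calc ∑ y ∈ R, F (y.shift μ) = ∑ z ∈ R.image (fun y : Site P j => y.shift μ), F z := (Finset.sum_image fun y _ y' _ h => hinj h).symm
    _ = ∑ y ∈ R, F y := by rw [himg]

omit [Fintype n] [DecidableEq n] in
/-- ★★★ **THE NULL SPACE FOR A GENERAL DETERMINING SET, MODULO THE LETTER (L) ONLY.**  `Q^{(·)}` a recursion family of the linearised (0.4) average; `𝐁` a determining set read up to level
`k`; (L) `hloop`: for every direction an `e_μ`-invariant nonempty finite set of sites at some level `j ≤ k` all of whose `μ`-bonds meet `Γ_j`.  Then a fine matrix-valued field with vanishing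
plaquette variables and `Q^{(j)}X = 0` on every bond meeting `Γ_j` (`j ≤ k`) is a pure gauge `X = dφ` whose potential is CONSTANT ALONG EVERY CONSTRAINED BOND read at the `j`-fold centres
(`φ(embIter j c₊) = φ(embIter j c₋)`) — i.e. `φ` is locally constant on the constrained-centre graph; conversely every such `dφ` is curl-free and in the joint kernel (`iterLin_grad`).  NOTE: for a
multi-level `𝐁` whose constrained-centre graph is disconnected this null space is LARGER than `Lie (4) = {dφ : φ = 0 at the constrained centres}` (different constants on different components:
at the exactly flat datum the symmetry group of the joint fibre exceeds (4)); a slice on which the flat Hessian is to be nondegenerate must be transversal to THIS space (print's hierarchical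
axial gauge is). [cite: Balaban1988Convergent, (2.2) p.255, (2.10)-(2.12) p.256; Balaban1985Variational, (4) p.278, Sect. E p.300; Balaban1984PropagatorsI, (1.72) p.30] -/
theorem exists_locConstGauge_of_plaq_eq_zero_of_iterLin_eq_zero_detSet
    (Q : (i : ℕ) → (PBond P 0 → Matrix n n ℂ) → PBond P i → Matrix n n ℂ)
    (hQ0 : ∀ Y, Q 0 Y = Y) (hQs : ∀ (i : ℕ) (Y : PBond P 0 → Matrix n n ℂ) (c : PBond P (i + 1)), Q (i + 1) Y c = linAvg (Q i Y) c)
    (𝔹 : DetSet P) (k : ℕ)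
    (hloop : ∀ μ : Fin P.d, ∃ (j : ℕ) (R : Finset (Site P j)), j ≤ k ∧ R.Nonempty ∧ (∀ y ∈ R, y.shift μ ∈ R) ∧
      ∀ y ∈ R, (⟨y, μ⟩ : PBond P j) ∈ bondsOf (𝔹 j))
    (X : PBond P 0 → Matrix n n ℂ)
    (hcurl : ∀ p : Plaq P 0, X ⟨p.src, p.μ⟩ + X ⟨p.src.shift p.μ, p.ν⟩ - X ⟨p.src.shift p.ν, p.μ⟩ - X ⟨p.src, p.ν⟩ = 0)
    (hQ : ∀ j, j ≤ k → ∀ c ∈ bondsOf (𝔹 j), Q j X c = 0) :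
    ∃ φ : Site P 0 → Matrix n n ℂ, (∀ j, j ≤ k → ∀ c ∈ bondsOf (𝔹 j), φ (embIter j c.tgt) = φ (embIter j c.src)) ∧
      ∀ b : PBond P 0, X b = φ b.tgt - φ b.src := by
  obtain ⟨φ₀, A, hX⟩ := exists_grad_add_dirConst_of_plaq_eq_zero_matrix X hcurl
  have hXf : X = fun b : PBond P 0 => (φ₀ b.tgt - φ₀ b.src) + A b.dir := funext hX
  -- `Q^{(j)}X = d(φ₀∘embIter j) + L^j·A₀ = 0` on the constrained bonds
  have hk : ∀ j, j ≤ k → ∀ c ∈ bondsOf (𝔹 j), φ₀ (embIter j c.tgt) - φ₀ (embIter j c.src) + (P.L ^ j : ℕ) • A c.dir = 0 := by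
    intro j hj c hc
    have h := hQ j hj c hc
    rw [hXf, iterLin_add Q hQ0 hQs (fun b : PBond P 0 => φ₀ b.tgt - φ₀ b.src) (fun b => A b.dir) j c,
      iterLin_grad Q hQ0 hQs (fun i φ y => φ (embIter i y)) (fun φ => rfl) (fun i φ y => rfl) φ₀ j c, iterLin_dirConst Q hQ0 hQs A j c] at h
    exact h
  -- (L): summing an essential loop kills the constant vector function
  have hA : ∀ μ : Fin P.d, A μ = 0 := fun μ => by
    obtain ⟨j, R, hj, hRne, hRsh, hRc⟩ := hloop μ
    have hsum : ∑ y ∈ R, (φ₀ (embIter j ((⟨y, μ⟩ : PBond P j).tgt)) - φ₀ (embIter j y) + (P.L ^ j : ℕ) • A μ) = 0 :=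
      Finset.sum_eq_zero fun y hy => hk j hj ⟨y, μ⟩ (hRc y hy)
    rw [Finset.sum_add_distrib, Finset.sum_sub_distrib] at hsum
    have htgt : ∑ y ∈ R, φ₀ (embIter j ((⟨y, μ⟩ : PBond P j).tgt)) = ∑ y ∈ R, φ₀ (embIter j y) :=
      sum_shift_finset_eq μ R hRsh (fun y => φ₀ (embIter j y))
    rw [htgt, sub_self, zero_add, Finset.sum_const, smul_smul, ← Nat.cast_smul_eq_nsmul ℂ, smul_eq_zero] at hsum
    exact hsum.resolve_left (Nat.cast_ne_zero.mpr (mul_ne_zero (Finset.card_ne_zero.mpr hRne) (pow_ne_zero _ P.L_pos.ne')))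
  refine ⟨φ₀, fun j hj c hc => ?_, fun b => by rw [hX b, hA, add_zero]⟩
  have h := hk j hj c hc
  rw [hA, smul_zero, add_zero, sub_eq_zero] at h
  exact h

omit [Fintype n] [DecidableEq n] in
/-- ★★ **THE JOINT FLAT NULL SPACE, CHARACTERISED** (modulo (L) for ⇒): «all plaquette variables of `X` vanish and `Q^{(j)}X = 0` on every bond meeting `Γ_j`, `j ≤ k`» ⟺ «`X = dφ` with
`φ` constant along every constrained bond at the `j`-fold centres». [cite: Balaban1988Convergent, (2.2) p.255; Balaban1985Variational, Sect. E p.300] -/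
theorem plaq_eq_zero_and_iterLin_eq_zero_iff_detSet
    (Q : (i : ℕ) → (PBond P 0 → Matrix n n ℂ) → PBond P i → Matrix n n ℂ)
    (hQ0 : ∀ Y, Q 0 Y = Y) (hQs : ∀ (i : ℕ) (Y : PBond P 0 → Matrix n n ℂ) (c : PBond P (i + 1)), Q (i + 1) Y c = linAvg (Q i Y) c)
    (𝔹 : DetSet P) (k : ℕ)
    (hloop : ∀ μ : Fin P.d, ∃ (j : ℕ) (R : Finset (Site P j)), j ≤ k ∧ R.Nonempty ∧ (∀ y ∈ R, y.shift μ ∈ R) ∧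
      ∀ y ∈ R, (⟨y, μ⟩ : PBond P j) ∈ bondsOf (𝔹 j))
    (X : PBond P 0 → Matrix n n ℂ) :
    ((∀ p : Plaq P 0, X ⟨p.src, p.μ⟩ + X ⟨p.src.shift p.μ, p.ν⟩ - X ⟨p.src.shift p.ν, p.μ⟩ - X ⟨p.src, p.ν⟩ = 0) ∧
        ∀ j, j ≤ k → ∀ c ∈ bondsOf (𝔹 j), Q j X c = 0) ↔
      ∃ φ : Site P 0 → Matrix n n ℂ, (∀ j, j ≤ k → ∀ c ∈ bondsOf (𝔹 j), φ (embIter j c.tgt) = φ (embIter j c.src)) ∧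
        ∀ b : PBond P 0, X b = φ b.tgt - φ b.src := by
  constructor
  · rintro ⟨hcurl, hQ⟩
    exact exists_locConstGauge_of_plaq_eq_zero_of_iterLin_eq_zero_detSet Q hQ0 hQs 𝔹 k hloop X hcurl hQ
  · rintro ⟨φ, hφ, hX⟩
    have hXf : X = fun b : PBond P 0 => φ b.tgt - φ b.src := funext hX
    refine ⟨fun p => ?_, fun j hj c hc => ?_⟩
    · have h := LatticeFieldCalculus.curl_grad (1 : ℝ) 1 φ p
      simp only [LatticeFieldCalculus.curl, LatticeFieldCalculus.grad, one_smul] at h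
      rw [hX, hX, hX, hX]
      exact h
    · rw [hXf, iterLin_grad Q hQ0 hQs (fun i φ y => φ (embIter i y)) (fun φ => rfl) (fun i φ y => rfl) φ j c, hφ j hj c hc, sub_self]

omit [Fintype n] [DecidableEq n] in
/-- ★★ **UNDER THE CONNECTIVITY LETTER (C) THE NULL SPACE IS `Lie (4)`**: if moreover (C) `hconn` holds — a fine site function constant along every constrained bond takes one value at the sources
of any two constrained bonds — the potential can be normalised to VANISH at both ends (as `j`-fold centres) of every constrained bond.
[cite: Balaban1988Convergent, (2.2) p.255; Balaban1985Variational, (4) p.278] -/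
theorem exists_constrGauge_of_plaq_eq_zero_of_iterLin_eq_zero_detSet
    (Q : (i : ℕ) → (PBond P 0 → Matrix n n ℂ) → PBond P i → Matrix n n ℂ)
    (hQ0 : ∀ Y, Q 0 Y = Y) (hQs : ∀ (i : ℕ) (Y : PBond P 0 → Matrix n n ℂ) (c : PBond P (i + 1)), Q (i + 1) Y c = linAvg (Q i Y) c)
    (𝔹 : DetSet P) (k : ℕ)
    (hloop : ∀ μ : Fin P.d, ∃ (j : ℕ) (R : Finset (Site P j)), j ≤ k ∧ R.Nonempty ∧ (∀ y ∈ R, y.shift μ ∈ R) ∧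
      ∀ y ∈ R, (⟨y, μ⟩ : PBond P j) ∈ bondsOf (𝔹 j))
    (hconn : ∀ ψ : Site P 0 → Matrix n n ℂ, (∀ j, j ≤ k → ∀ c ∈ bondsOf (𝔹 j), ψ (embIter j c.tgt) = ψ (embIter j c.src)) →
      ∀ j j', j ≤ k → j' ≤ k → ∀ c ∈ bondsOf (𝔹 j), ∀ c' ∈ bondsOf (𝔹 j'), ψ (embIter j c.src) = ψ (embIter j' c'.src))
    (X : PBond P 0 → Matrix n n ℂ)
    (hcurl : ∀ p : Plaq P 0, X ⟨p.src, p.μ⟩ + X ⟨p.src.shift p.μ, p.ν⟩ - X ⟨p.src.shift p.ν, p.μ⟩ - X ⟨p.src, p.ν⟩ = 0)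
    (hQ : ∀ j, j ≤ k → ∀ c ∈ bondsOf (𝔹 j), Q j X c = 0) :
    ∃ φ : Site P 0 → Matrix n n ℂ, (∀ j, j ≤ k → ∀ c ∈ bondsOf (𝔹 j), φ (embIter j c.src) = 0 ∧ φ (embIter j c.tgt) = 0) ∧
      ∀ b : PBond P 0, X b = φ b.tgt - φ b.src := by
  obtain ⟨φ₀, hconst, hX⟩ := exists_locConstGauge_of_plaq_eq_zero_of_iterLin_eq_zero_detSet Q hQ0 hQs 𝔹 k hloop X hcurl hQ
  obtain ⟨j₀, R₀, hj₀, ⟨y₀, hy₀⟩, -, hR₀c⟩ := hloop ⟨0, P.hd⟩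
  set κ : Matrix n n ℂ := φ₀ (embIter j₀ (⟨y₀, (⟨0, P.hd⟩ : Fin P.d)⟩ : PBond P j₀).src) with hκ
  refine ⟨fun x => φ₀ x - κ, fun j hj c hc => ?_, fun b => by rw [hX b, sub_sub_sub_cancel_right]⟩
  have hsrc : φ₀ (embIter j c.src) = κ := hconn φ₀ hconst j j₀ hj hj₀ c hc _ (hR₀c y₀ hy₀)
  refine ⟨by rw [sub_eq_zero]; exact hsrc, by rw [sub_eq_zero, hconst j hj c hc]; exact hsrc⟩

omit [Fintype n] [DecidableEq n] in
/-- ★★ **THE `hnd` SHAPE FOR A GENERAL DETERMINING SET**: on any set `S` of fine fields transversal to the pure gauges `dφ` whose potential is constant along every constrained bond at the centres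
(DISPLAYED slice letter `hS` — the hierarchical axial gauge of print satisfies it), under (L): `X ∈ S`, all plaquette variables of `X` vanish, `Q^{(j)}X = 0` on every bond meeting `Γ_j`
(`j ≤ k`) ⟹ `X = 0`. [cite: Balaban1989LargeFieldII, (1.9) p.358, p.359; Balaban1988Convergent, (2.2) p.255] -/
theorem eq_zero_of_transversal_of_iterLin_eq_zero_detSet
    (Q : (i : ℕ) → (PBond P 0 → Matrix n n ℂ) → PBond P i → Matrix n n ℂ)
    (hQ0 : ∀ Y, Q 0 Y = Y) (hQs : ∀ (i : ℕ) (Y : PBond P 0 → Matrix n n ℂ) (c : PBond P (i + 1)), Q (i + 1) Y c = linAvg (Q i Y) c)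
    (𝔹 : DetSet P) (k : ℕ)
    (hloop : ∀ μ : Fin P.d, ∃ (j : ℕ) (R : Finset (Site P j)), j ≤ k ∧ R.Nonempty ∧ (∀ y ∈ R, y.shift μ ∈ R) ∧
      ∀ y ∈ R, (⟨y, μ⟩ : PBond P j) ∈ bondsOf (𝔹 j))
    {S : Set (PBond P 0 → Matrix n n ℂ)}
    (hS : ∀ φ : Site P 0 → Matrix n n ℂ, (∀ j, j ≤ k → ∀ c ∈ bondsOf (𝔹 j), φ (embIter j c.tgt) = φ (embIter j c.src)) →
      (fun b : PBond P 0 => φ b.tgt - φ b.src) ∈ S → ∀ b : PBond P 0, φ b.tgt - φ b.src = 0)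
    {X : PBond P 0 → Matrix n n ℂ} (hXS : X ∈ S)
    (hcurl : ∀ p : Plaq P 0, X ⟨p.src, p.μ⟩ + X ⟨p.src.shift p.μ, p.ν⟩ - X ⟨p.src.shift p.ν, p.μ⟩ - X ⟨p.src, p.ν⟩ = 0)
    (hQ : ∀ j, j ≤ k → ∀ c ∈ bondsOf (𝔹 j), Q j X c = 0) : X = 0 := by
  obtain ⟨φ, hφ, hX⟩ := exists_locConstGauge_of_plaq_eq_zero_of_iterLin_eq_zero_detSet Q hQ0 hQs 𝔹 k hloop X hcurl hQ
  have hXf : X = fun b : PBond P 0 => φ b.tgt - φ b.src := funext hX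
  funext b
  rw [hX b, Pi.zero_apply]
  exact hS φ hφ (hXf ▸ hXS) b

end Torus

/-! ## §2 At NODE 00's flat multi-scale chart: general level-bounded determining sets -/

section NodeZero

variable {F : T4Family} {N : ℕ} [NeZero N] {K k : ℕ}

/-- For a determining set with no member above `k`, the kernel of `DΦ(0)` (`Φ = msChart F N K k 𝔹 (M˙1) 1`) kills `(Q^{(j)}↑X)(c)` at EVERY constrained bond `(j, c)`, `j ≤ k`.
[cite: Balaban1985Variational, (44)-(48) p.285; Balaban1988Convergent, (2.10)-(2.12) p.256] -/
theorem iterLin_eq_zero_of_fderiv_msChart_one_eq_zero_detSet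
    (Q : (i : ℕ) → (PBond (F.P K) 0 → Matrix (Fin N) (Fin N) ℂ) → PBond (F.P K) i → Matrix (Fin N) (Fin N) ℂ)
    (hQ0 : ∀ Y, Q 0 Y = Y) (hQs : ∀ (i : ℕ) (Y : PBond (F.P K) 0 → Matrix (Fin N) (Fin N) ℂ) (c : PBond (F.P K) (i + 1)), Q (i + 1) Y c = linAvg (Q i Y) c)
    (𝔹 : DetSet (F.P K)) {X : PBond (F.P K) 0 → lieSU (Fin N)}
    (hker : fderiv ℝ (msChart F N K k 𝔹 (avgFamily (avOfRecord F N K) (1 : GaugeField (F.P K) 0 (SU N))) (1 : GaugeField (F.P K) 0 (SU N))) 0 X = 0)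
    {j : ℕ} (hj : j ≤ k) {c : PBond (F.P K) j} (hc : c ∈ bondsOf (𝔹 j)) :
    Q j (fun b => (X b : Matrix (Fin N) (Fin N) ℂ)) c = 0 := by
  set i : Fin (constrCard 𝔹 k) := constrEnum 𝔹 k ⟨⟨j, Nat.lt_succ_of_le hj⟩, ⟨c, hc⟩⟩ with hi
  have h := fderiv_msChart_one_apply_eq_iterLin (F := F) (N := N) (K := K) (k := k) Q hQ0 hQs 𝔹 X i
  rw [hker, hi, Equiv.symm_apply_apply] at h
  have hmem : Q j (fun b => (X b : Matrix (Fin N) (Fin N) ℂ)) c ∈ lieSU (Fin N) := iterLin_mem_lieSU Q hQ0 hQs (fun b => (X b).2) j c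
  have h' := congrArg (fun Z : lieSU (Fin N) => (Z : Matrix (Fin N) (Fin N) ℂ)) h
  simp only [Pi.zero_apply, ZeroMemClass.coe_zero] at h'
  rw [coe_suProj_of_mem hmem] at h'
  exact h'.symm

/-- ★★★ **`hnd` AT NODE 00's FLAT CHART FOR A GENERAL DETERMINING SET (read up to level `k`), MODULO (L) AND THE SLICE LETTER**: `X ∈ S` (a set of fine `𝔰𝔲(N)`-fields transversal to the
pure gauges whose potential is constant along every constrained bond at the centres), `DΦ(0)X = 0`, `d²∕ds² A(e^{sX})|₀ = 0` ⟹ `X = 0`.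
[cite: Balaban1989LargeFieldII, (1.9) p.358, p.359; Balaban1988Convergent, (2.2) p.255, (2.14) p.257; Balaban1989LargeFieldI, (1.14)-(1.16) pp.179-180] -/
theorem eq_zero_of_fderiv_msChart_one_eq_zero_of_transversal_detSet (𝔹 : DetSet (F.P K))
    (hloop : ∀ μ : Fin (F.P K).d, ∃ (j : ℕ) (R : Finset (Site (F.P K) j)), j ≤ k ∧ R.Nonempty ∧ (∀ y ∈ R, y.shift μ ∈ R) ∧
      ∀ y ∈ R, (⟨y, μ⟩ : PBond (F.P K) j) ∈ bondsOf (𝔹 j))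
    {S : Set (PBond (F.P K) 0 → lieSU (Fin N))}
    (hS : ∀ φ : Site (F.P K) 0 → lieSU (Fin N), (∀ j, j ≤ k → ∀ c ∈ bondsOf (𝔹 j), φ (embIter j c.tgt) = φ (embIter j c.src)) →
      (fun b : PBond (F.P K) 0 => φ b.tgt - φ b.src) ∈ S → ∀ b : PBond (F.P K) 0, φ b.tgt - φ b.src = 0)
    {X : PBond (F.P K) 0 → lieSU (Fin N)} (hXS : X ∈ S)
    (hker : fderiv ℝ (msChart F N K k 𝔹 (avgFamily (avOfRecord F N K) (1 : GaugeField (F.P K) 0 (SU N))) (1 : GaugeField (F.P K) 0 (SU N))) 0 X = 0)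
    (hflat : deriv (deriv fun s : ℝ => wilsonAction4 (expChart (1 : GaugeField (F.P K) 0 (SU N)) (s • X))) 0 = 0) :
    X = 0 := by
  obtain ⟨Q, hQ0, hQs⟩ : ∃ Q : (i : ℕ) → (PBond (F.P K) 0 → Matrix (Fin N) (Fin N) ℂ) → PBond (F.P K) i → Matrix (Fin N) (Fin N) ℂ,
      (∀ Y, Q 0 Y = Y) ∧ ∀ (i : ℕ) (Y : PBond (F.P K) 0 → Matrix (Fin N) (Fin N) ℂ) (c : PBond (F.P K) (i + 1)), Q (i + 1) Y c = linAvg (Q i Y) c :=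
    ⟨fun i => Nat.rec (motive := fun i => (PBond (F.P K) 0 → Matrix (Fin N) (Fin N) ℂ) → PBond (F.P K) i → Matrix (Fin N) (Fin N) ℂ) (fun Y => Y)
      (fun _ Qi Y c => linAvg (Qi Y) c) i, fun _ => rfl, fun _ _ _ => rfl⟩
  have hQ : ∀ j, j ≤ k → ∀ c ∈ bondsOf (𝔹 j), Q j (fun b => (X b : Matrix (Fin N) (Fin N) ℂ)) c = 0 := fun j hj c hc =>
    iterLin_eq_zero_of_fderiv_msChart_one_eq_zero_detSet Q hQ0 hQs 𝔹 hker hj hc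
  have hcurl := coe_plaq_eq_zero_of_deriv_deriv_eq_zero X hflat
  obtain ⟨φ₀, hφ₀, hXφ₀⟩ := exists_locConstGauge_of_plaq_eq_zero_of_iterLin_eq_zero_detSet Q hQ0 hQs 𝔹 k hloop
    (fun b => (X b : Matrix (Fin N) (Fin N) ℂ)) hcurl hQ
  -- normalise the potential at one site so that it is `𝔰𝔲(N)`-valued (membership propagates along bonds)
  set φ₁ : Site (F.P K) 0 → Matrix (Fin N) (Fin N) ℂ := fun x => φ₀ x - φ₀ default with hφ₁
  have hXφ₁ : ∀ b : PBond (F.P K) 0, (X b : Matrix (Fin N) (Fin N) ℂ) = φ₁ b.tgt - φ₁ b.src := fun b => by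
    rw [hXφ₀ b, hφ₁, sub_sub_sub_cancel_right]
  have hmem : ∀ x, φ₁ x ∈ lieSU (Fin N) := fun x =>
    mem_of_sub_mem (lieSU (Fin N)).toAddSubgroup φ₁ (fun b => by rw [← hXφ₁ b]; exact (X b).2)
      (x₀ := default) (by rw [hφ₁]; simp only [sub_self]; exact (lieSU (Fin N)).zero_mem) x
  set φ : Site (F.P K) 0 → lieSU (Fin N) := fun x => ⟨φ₁ x, hmem x⟩ with hφdef
  have hφ : ∀ j, j ≤ k → ∀ c ∈ bondsOf (𝔹 j), φ (embIter j c.tgt) = φ (embIter j c.src) := fun j hj c hc =>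
    Subtype.ext (by show φ₁ _ = φ₁ _; rw [hφ₁]; simp only [hφ₀ j hj c hc])
  have hXφ : (fun b : PBond (F.P K) 0 => φ b.tgt - φ b.src) = X :=
    funext fun b => Subtype.ext (by rw [Submodule.coe_sub, hXφ₁ b])
  have h0 := hS φ hφ (hXφ ▸ hXS)
  funext b
  have hb : X b = φ b.tgt - φ b.src := (congrFun hXφ b).symm
  rw [hb, Pi.zero_apply]
  exact h0 b

/-- ★★ **POSITIVITY FORM** for a general determining set (read up to level `k`), modulo (L) and the slice letter: `X ∈ S`, `X ≠ 0`, `DΦ(0)X = 0` ⟹ `0 < d²∕ds² A(e^{sX})|₀`.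
[cite: Balaban1989LargeFieldII, (1.9) p.358, p.359; Balaban1988Convergent, (2.2) p.255] -/
theorem deriv_deriv_pos_of_fderiv_msChart_one_eq_zero_of_transversal_detSet (𝔹 : DetSet (F.P K))
    (hloop : ∀ μ : Fin (F.P K).d, ∃ (j : ℕ) (R : Finset (Site (F.P K) j)), j ≤ k ∧ R.Nonempty ∧ (∀ y ∈ R, y.shift μ ∈ R) ∧
      ∀ y ∈ R, (⟨y, μ⟩ : PBond (F.P K) j) ∈ bondsOf (𝔹 j))
    {S : Set (PBond (F.P K) 0 → lieSU (Fin N))}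
    (hS : ∀ φ : Site (F.P K) 0 → lieSU (Fin N), (∀ j, j ≤ k → ∀ c ∈ bondsOf (𝔹 j), φ (embIter j c.tgt) = φ (embIter j c.src)) →
      (fun b : PBond (F.P K) 0 => φ b.tgt - φ b.src) ∈ S → ∀ b : PBond (F.P K) 0, φ b.tgt - φ b.src = 0)
    {X : PBond (F.P K) 0 → lieSU (Fin N)} (hXS : X ∈ S) (hX0 : X ≠ 0)
    (hker : fderiv ℝ (msChart F N K k 𝔹 (avgFamily (avOfRecord F N K) (1 : GaugeField (F.P K) 0 (SU N))) (1 : GaugeField (F.P K) 0 (SU N))) 0 X = 0) :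
    0 < deriv (deriv fun s : ℝ => wilsonAction4 (expChart (1 : GaugeField (F.P K) 0 (SU N)) (s • X))) 0 :=
  lt_of_le_of_ne (deriv_deriv_wilsonAction4_expChart_one_nonneg X) fun h =>
    hX0 (eq_zero_of_fderiv_msChart_one_eq_zero_of_transversal_detSet 𝔹 hloop hS hXS hker h.symm)

end NodeZero

/-! ## §3 Sanity instance: the whole-lattice `k`-fold constraint `atScale k` satisfies (L) and (C) -/

section AtScale

variable {P : Params}

/-- **(L) for `atScale k`**: at level `k` every bond is constrained, so the whole site set of `T^{(k)}` is an `e_μ`-invariant nonempty family of constrained `μ`-bonds.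
[cite: Balaban1985Variational, (5) p.278; Balaban1988Convergent, (2.2) p.255] -/
theorem hloop_atScale (k : ℕ) (μ : Fin P.d) :
    ∃ (j : ℕ) (R : Finset (Site P j)), j ≤ k ∧ R.Nonempty ∧ (∀ y ∈ R, y.shift μ ∈ R) ∧
      ∀ y ∈ R, (⟨y, μ⟩ : PBond P j) ∈ bondsOf ((atScale k : DetSet P) j) :=
  ⟨k, Finset.univ, le_rfl, Finset.univ_nonempty, fun y _ => Finset.mem_univ _, fun y _ => by simp [atScale, bondsOf]⟩

/-- **(C) for `atScale k`**: a fine site function whose level-`k` centre values agree across every level-`k` bond is constant on the `k`-fold centres (the torus `T^{(k)}` is connected by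
unit translations, `N12FlatFibreNullSpace.const_of_shift_eq`); the other levels carry no constraint. [cite: Balaban1985Variational, (5) p.278; Balaban1988Convergent, (2.2) p.255] -/
theorem hconn_atScale {V : Type*} [AddCommGroup V] (k : ℕ) (ψ : Site P 0 → V)
    (hψ : ∀ j, j ≤ k → ∀ c ∈ bondsOf ((atScale k : DetSet P) j), ψ (embIter j c.tgt) = ψ (embIter j c.src)) :
    ∀ j j', j ≤ k → j' ≤ k → ∀ c ∈ bondsOf ((atScale k : DetSet P) j), ∀ c' ∈ bondsOf ((atScale k : DetSet P) j'),
      ψ (embIter j c.src) = ψ (embIter j' c'.src) := by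
  -- only level `k` carries constrained bonds
  have hlev : ∀ j (c : PBond P j), c ∈ bondsOf ((atScale k : DetSet P) j) → j = k := fun j c hc => by
    by_contra hne
    simp [atScale, bondsOf, hne] at hc
  have hconst : ∀ y : Site P k, ψ (embIter k y) = ψ (embIter k (B5Positivity172Lattice.ofT (0 : B5Positivity172Lattice.TT P k))) :=
    N12FlatFibreNullSpace.const_of_shift_eq (fun y => ψ (embIter k y))
      (fun y μ => hψ k le_rfl ⟨y, μ⟩ (by simp [atScale, bondsOf]))
  intro j j' hj hj' c hc c' hc'
  obtain rfl := hlev j c hc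
  obtain rfl := hlev j' c' hc'
  rw [hconst c.src, hconst c'.src]

end AtScale

end Summit.QuantumFields.YangMills.BalabanUVNodes.N12FlatFibreNullSpaceDetSet

end
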